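/-
lean1 cell, LEAN TYPING SEAT 1 (unit `b2b-lace-lean1-g39`): Rev3 of the KU-SEP swap tables at `d := 10` — the node `K` table with the
two slots of the atom `K_{3,7}(0;10)` (`.n0` at `l = 7`, `.e1` at `l = 6`) replaced by the landed polynomial-majorant cell
`SrwKSevenOriginCellD10`, the `T^{(5.11)}`-rule table re-read on it, and the node-slot chain reading the Rev3 `K` / `T` tables and the Rev2
`U` table.  Additive and thin: Rev1 (`KUSepD10`) and Rev2 (`KUSepD10R2`) are imported and used BY NAME, nothing is restated; no module is
modified, no table of record is touched; every override is a landed theorem read by name; no numeral of record, no tuple, no certificate of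
record, no dimension sentence.
-/
import Literature.Probability.FitznerVanDerHofstad2017.SrwKTUTablesD10KUSepRev2
import Literature.Probability.FitznerVanDerHofstad2017.SrwKSevenOriginCellD10
import HarnessLib

/-!
# KU-SEP swap tables at `d := 10`, Rev3: the certified-majorant `K_{3,7}(0)` cell wired into the node `K` table (what-if lane)

[NoBLE17] = R. Fitzner, R. van der Hofstad, *Generalized approach to the non-backtracking lace expansion*, PTRF **169** (2017)
1041–1119 (arXiv:1506.07969; bib key `FitznerVanDerHofstad2016NoBLE`): (3.36), (3.38) p. 1071 (`K_{n,l}(x)`, `U_{n,l}(x)`),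
§5.2 (5.9)–(5.15) p. 1092 (the numerical bounds of `K`, `T`, `U`), §3.3.5 (3.72) p. 1077 (the `T*`-slot `K_{m,l+1} + (2/α̲) U_{m+1,l}`
and the rule (5.11)), (3.87) p. 1079 (the cell bound of `f₃` reading the tables); its numerical inputs are the ones consumed by [FvdH17] =
R. Fitzner, R. van der Hofstad, *Mean-field behavior for nearest-neighbor percolation in `d > 10`*, EJP **22** (2017) no. 43
(arXiv:1506.07977).

WHAT-IF LANE at the SRW-table parameter `d := 10`: every statement below is an unconditional real-analysis inequality about the integrals
`srwU 10 …`, `srwK 10 …`, `srwTS 10 …` and the majorant `boundHD75Phi (srwTrueAlt 10 …)`, or a definition of a rational table; nothing is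
asserted about percolation in any dimension and no table of record is modified.

* §1 `kAX n l nd` — the Rev1 node `K` table `KUSepD10.kAX` with the two slots of the atom `K_{3,7}(0;10)` replaced by the literal
  `12448722854 / 10¹²` of `KPolyOriginD10.srwK_origin_d10_n3_l7` / `srwK_unit_d10_n3_l6` (a kernel-certified degree-32 polynomial majorant
  of `|t|^7` closed on the origin seed table; the Rev1 slot carries the Schwarz / log-convexity value `0.012731117488`); every other slot is
  `KUSepD10.kAX n l nd` by name.  Soundness `srwK_le_kAX` in the exact shape of `KUSepD10.srwK_le_kAX`.
* §2 the `T^{(5.11)}`-rule literal table `tAXr` / `tAX = min (KUSepD10.tAX) (tAXr)` re-read on the Rev3 `kAX` (twin of `KUSepD10.tAXr/tAX`,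
  rule check decided by `tRule`), soundness `srwTS_le_tAX_pt`.
* §3 the node direct-slot table `tNDQX α nd m l = min (tAX m l nd) (kAX m (l+1) nd + (2/α)·KUSepD10R2.uAX (m+1) l nd)`, the real heads
  `kNX`, `tNDX`, and the point soundness theorems `srwK_pt_leX`, `srwTS_pt_le_tNDX` (the Rev2 `U` head `KUSepD10R2.uNX` is used by name).
* §4 the node cell theorems `f3cellD10DX_{zero,one}_at_le_phi`, the closing rule `boundHD75Phi_cellNDX_le_of_ratLe` and the node slot
  theorems `slotNDX_{zero,one}_at_le_phi` — twins of `KUSepD10R2` §3 with conclusions VERBATIM the same and the numeral hypothesis `hnum`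
  reading `tNDQX` (Rev3), `KUSepD10R2.uAX`, `kAX` (Rev3): a consumer re-decides a node row by renaming `KUSepD10R2.tNDQX ↦ KUSepD10R3.tNDQX`,
  `KUSepD10.kAX ↦ KUSepD10R3.kAX` and the slot theorem; the `𝒳` / `Q` / cone rows do not read the node tables and keep Rev1's theorems.
-/

noncomputable section

namespace Literature.Probability.FitznerVanDerHofstad2017

namespace KUSepD10R3

open Literature.Barriers.CriticalPhenomena Literature.Probability.LatticeModels
open F3Bounds F3Bounds.CellNumQ KTUD10 KSupD10 TUSupD10 CellSupD10 CellImD10 SlotD10 SlotD10Phi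
open scoped BigOperators

/-! ### §0  Node points -/

/-- [folklore] -/
private theorem pt_n0 : Nd.pt .n0 = 0 := by decide +kernel

/-- [folklore] -/
private theorem pt_e1 : Nd.pt .e1 = Pi.single (0 : Fin 10) (1 : ℤ) := by decide +kernel

/-! ### §1  The Rev3 node `K` table and its soundness -/

/-- **Rev3 node `K` table**: `KUSepD10.kAX n l nd` with the two slots of the atom `K_{3,7}(0;10)` replaced by the landed certified-majorant
literal of `KPolyOriginD10` (`.n0` at `l = 7`, `.e1` at `l = 6`, the same atom by `K_{n,l}(e₀) = K_{n,l+1}(0)`). [cite: FitznerVanDerHofstad2016NoBLE, (3.36) p. 1071; §5.2 (5.14), (5.15) p. 1092] -/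
def kAX (n l : ℕ) (nd : Nd) : ℚ :=
  match n, l, nd with
  | 3, 7, .n0 => 12448722854 / 1000000000000
  | 3, 6, .e1 => 12448722854 / 1000000000000
  | _, _, _ => KUSepD10.kAX n l nd

/-- **Soundness of the Rev3 `kAX`**: `K_{n,l}(nd.pt; 10) ≤ kAX n l nd` for `1 ≤ n ≤ 4`, `l ≤ 22` — the two overrides are the landed cell
theorems `KPolyOriginD10.srwK_origin_d10_n3_l7` / `srwK_unit_d10_n3_l6 0`, the fallback is `KUSepD10.srwK_le_kAX`. [cite: FitznerVanDerHofstad2016NoBLE, (3.36) p. 1071; §5.2 (5.14), (5.15) p. 1092] -/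
theorem srwK_le_kAX (nd : Nd) {n : ℕ} (hn1 : 1 ≤ n) (hn : n ≤ 4) {l : ℕ} (hl : l ≤ 22) :
    srwK 10 n l nd.pt ≤ ((kAX n l nd : ℚ) : ℝ) := by
  unfold kAX
  split
  · rw [pt_n0]; exact KPolyOriginD10.srwK_origin_d10_n3_l7
  · rw [pt_e1]; exact KPolyOriginD10.srwK_unit_d10_n3_l6 0
  · exact KUSepD10.srwK_le_kAX nd hn1 hn hl

/-! ### §2  The `T^{(5.11)}`-rule literals on the Rev3 `K` table -/

/-- The (5.11)-rule value on the Rev3 `kAX` at the node `nd`: `kAX m (l+1) + min ((4/10) kAX m l, (2/10) kAX (m+1) l)` — twin of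
`KUSepD10.tAXr`. [cite: FitznerVanDerHofstad2016NoBLE, §5.2 (5.11) p. 1092; §3.3.5 (3.72) p. 1077] -/
def tAXr (m l : ℕ) (nd : Nd) : ℚ := kAX m (l + 1) nd + min (4 / 10 * kAX m l nd) (2 / 10 * kAX (m + 1) l nd)

/-- **Rev3 node `T^{(5.11)}`-slot table**: `min (KUSepD10.tAX m l nd) (tAXr m l nd)` — twin of `KUSepD10.tAX`. [cite: FitznerVanDerHofstad2016NoBLE, §5.2 (5.11) p. 1092; §3.3.5 (3.72) p. 1077] -/
def tAX (m l : ℕ) (nd : Nd) : ℚ := min (KUSepD10.tAX m l nd) (tAXr m l nd)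

/-- [folklore] -/
private theorem taXChk_all (nd : Nd) : ∀ m ≤ 3, 1 ≤ m → ∀ l ≤ 21, tRule (fun n l => kAX n l nd) m l (tAXr m l nd) = true := by
  cases nd <;> decide +kernel

/-- **`T^{(5.11)}`-slot AT a node, Rev3**: `srwTS 10 a m l nd.pt ≤ tAX m l nd` for `1 ≤ a`, `1 ≤ m ≤ 3`, `l ≤ 21` — `min` of Rev1's
`KUSepD10.srwTS_le_tAX_pt` and the rule on the Rev3 `kAX` (`CellSupD10.srwTS_le_of_tRule` with `srwK_le_kAX`). [cite: FitznerVanDerHofstad2016NoBLE, §5.2 (5.11) p. 1092; §3.3.5 (3.72) p. 1077] -/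
theorem srwTS_le_tAX_pt {a : ℝ} (ha : 1 ≤ a) (nd : Nd) {m : ℕ} (hm1 : 1 ≤ m) (hm : m ≤ 3) {l : ℕ} (hl : l ≤ 21) :
    srwTS 10 a m l nd.pt ≤ ((tAX m l nd : ℚ) : ℝ) := by
  simp only [tAX, Rat.cast_min]
  exact le_min (KUSepD10.srwTS_le_tAX_pt ha nd hm1 hm hl)
    (srwTS_le_of_tRule ha hm1 hm hl nd.pt (fun n l => kAX n l nd) _ (fun _ hn' hn1' _ hl' => srwK_le_kAX nd hn1' hn' hl')
      (taXChk_all nd m hm hm1 l hl))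

/-! ### §3  The node direct-slot table over `ℚ`, the real heads, and the point soundness theorems -/

/-- `ℚ` direct `T`-slot table AT the node `nd`, Rev3: `min (tAX m l nd) (kAX m (l+1) nd + (2/α)·KUSepD10R2.uAX (m+1) l nd)` — twin of
`SlotD10.tNDQ` / `KUSepD10R2.tNDQX` reading the Rev3 `K` / `T` tables and the Rev2 `U` table. [cite: FitznerVanDerHofstad2016NoBLE, §5.2 (5.9), (5.11), (5.15) p. 1092; §3.3.5 (3.87) p. 1079] -/
def tNDQX (α : ℚ) (nd : Nd) (m l : ℕ) : ℚ := min (tAX m l nd) (kAX m (l + 1) nd + 2 / α * KUSepD10R2.uAX (m + 1) l nd)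

/-- Real head of the Rev3 node `K` table (twin of `CellSupD10.kN` / `KUSepD10.kNX`). [cite: FitznerVanDerHofstad2016NoBLE, (3.36) p. 1071; §5.2 (5.15) p. 1092] -/
def kNX (nd : Nd) (n l : ℕ) : ℝ := ((kAX n l nd : ℚ) : ℝ)

/-- Real head of the Rev3 direct `T`-slot table at a node (twin of `CellSupD10.tND` at rational `α`). [cite: FitznerVanDerHofstad2016NoBLE, §5.2 (5.9), (5.11), (5.15) p. 1092; §3.3.5 (3.87) p. 1079] -/
def tNDX (α : ℚ) (nd : Nd) (m l : ℕ) : ℝ := ((tNDQX α nd m l : ℚ) : ℝ)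

/-- `K_{n,l}(nd.pt) ≤ kNX nd n l` (`1 ≤ n ≤ 4`, `l ≤ 22`) — twin of `CellSupD10.srwK_pt_le` / `KUSepD10.srwK_pt_leX`. [cite: FitznerVanDerHofstad2016NoBLE, (3.36) p. 1071; §5.2 (5.15) p. 1092] -/
theorem srwK_pt_leX (nd : Nd) {n : ℕ} (hn1 : 1 ≤ n) (hn : n ≤ 4) {l : ℕ} (hl : l ≤ 22) :
    srwK 10 n l nd.pt ≤ kNX nd n l :=
  srwK_le_kAX nd hn1 hn hl

/-- `srwTS 10 α m l (nd.pt) ≤ tNDX α nd m l` (`1 ≤ α`, `1 ≤ m ≤ 3`, `l ≤ 17`) — twin of `CellSupD10.srwTS_pt_le_tND` / `KUSepD10R2.srwTS_pt_le_tNDX`: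
the rule branch is the Rev3 `srwTS_le_tAX_pt`, the direct branch `CellSupD10.srwTS_le_direct` with the Rev3 `srwK_le_kAX` and the Rev2
`KUSepD10R2.srwU_le_uAX`. [cite: FitznerVanDerHofstad2016NoBLE, §5.2 (5.9), (5.11), (5.15) p. 1092; §3.3.5 (3.87) p. 1079] -/
theorem srwTS_pt_le_tNDX {α : ℚ} (hα : 1 ≤ α) (nd : Nd) {m : ℕ} (hm1 : 1 ≤ m) (hm : m ≤ 3) {l : ℕ} (hl : l ≤ 17) :
    srwTS 10 (α : ℝ) m l nd.pt ≤ tNDX α nd m l := by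
  have hαR : (1 : ℝ) ≤ (α : ℝ) := by exact_mod_cast hα
  simp only [tNDX, tNDQX, Rat.cast_min, Rat.cast_add, Rat.cast_mul, Rat.cast_div, Rat.cast_ofNat]
  exact le_min (srwTS_le_tAX_pt hαR nd hm1 hm (by omega))
    (srwTS_le_direct (by linarith) nd.pt (srwK_le_kAX nd hm1 (by omega) (by omega))
      (KUSepD10R2.srwU_le_uAX nd (by omega) (by omega) hl))

/-! ### §4  The node cell theorems, the closing rule and the node slot theorems, wired to the Rev3 / Rev2 tables -/

section Wired

variable {α : ℚ} {afmax : ℝ}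

/-- **Cell `(0,l)` AT the node `nd`, `boundHD75Phi`, Rev3 direct `T` slot `tNDX α nd`** (`l ≤ 16`) — twin of
`KUSepD10R2.f3cellD10DX_zero_at_le_phi` with the Rev3 `K` head `kNX`. [cite: FitznerVanDerHofstad2016NoBLE, §3.3.5 (3.87) p. 1079; (3.58)–(3.64) p. 1076; §5.2 (5.9), (5.15) p. 1092] [cite: FitznerVanDerHofstad2017, §2.5] -/
theorem f3cellD10DX_zero_at_le_phi (hα : 1 ≤ α) {a : Args} (ha : a.WF) (nd : Nd)
    {IMc : ℤ → ℕ → ℝ} {l : ℕ} (hl : l ≤ 16) {b : ℝ}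
    (hE0 : (srwTrueAlt 10 (α : ℝ) afmax).IM 0 l nd.pt ≤ IMc 0 l) (hE0' : (srwTrueAlt 10 (α : ℝ) afmax).IM 0 (l + 1) nd.pt ≤ IMc 0 (l + 1))
    (hN1 : srwI 10 1 (l + 1) nd.pt + srwIShift2 10 2 l nd.pt / (2 * ((10 : ℕ) : ℝ) ^ 2 * (α : ℝ)) ≤ IMc (-1) l)
    (hN2 : srwI 10 2 l nd.pt ≤ ((10 : ℕ) : ℝ) * (α : ℝ) * IMc (-1) l)
    (hnum : boundHD75Phi (Tables.cell IMc (tNDX α nd) (KUSepD10R2.uNX nd) (kNX nd) : Tables (Fin 10 → ℤ)) 0 l 0 a ≤ b) :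
    boundHD75Phi (srwTrueAlt 10 (α : ℝ) afmax) 0 l nd.pt a ≤ b :=
  have hαR : (1 : ℝ) ≤ (α : ℝ) := by exact_mod_cast hα
  boundHD75Phi_srwTrueAlt_zero_at_le (by norm_num) (by linarith) ha nd.pt hE0 hE0' hN1 hN2
    (srwTS_pt_le_tNDX hα nd (by norm_num) (by norm_num) (by omega)) (srwTS_pt_le_tNDX hα nd (by norm_num) (by norm_num) (by omega))
    (srwTS_pt_le_tNDX hα nd (by norm_num) (by norm_num) (by omega))
    (KUSepD10R2.srwU_pt_leX nd (by norm_num) (by norm_num) (by omega)) (KUSepD10R2.srwU_pt_leX nd (by norm_num) (by norm_num) (by omega))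
    (srwK_pt_leX nd (by norm_num) (by norm_num) (by omega)) (srwK_pt_leX nd (by norm_num) (by norm_num) (by omega)) hnum

/-- **Cells `(1,l)` AT the node `nd`, `boundHD75Phi`, Rev3 direct `T` slot `tNDX α nd`** (`l ≤ 16`) — twin of
`KUSepD10R2.f3cellD10DX_one_at_le_phi` with the Rev3 `K` head `kNX`. [cite: FitznerVanDerHofstad2016NoBLE, §3.3.5 (3.87) p. 1079; (3.58)–(3.64) p. 1076; §5.2 (5.9), (5.15) p. 1092] [cite: FitznerVanDerHofstad2017, §2.5] -/
theorem f3cellD10DX_one_at_le_phi (hα : 1 ≤ α) {a : Args} (ha : a.WF) (nd : Nd)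
    {IMc : ℤ → ℕ → ℝ} {l : ℕ} (hl : l ≤ 16) {b : ℝ}
    (hE1 : (srwTrueAlt 10 (α : ℝ) afmax).IM 1 l nd.pt ≤ IMc 1 l) (hE0 : (srwTrueAlt 10 (α : ℝ) afmax).IM 0 l nd.pt ≤ IMc 0 l)
    (hE1' : (srwTrueAlt 10 (α : ℝ) afmax).IM 1 (l + 1) nd.pt ≤ IMc 1 (l + 1))
    (hE0' : (srwTrueAlt 10 (α : ℝ) afmax).IM 0 (l + 1) nd.pt ≤ IMc 0 (l + 1))
    (hE1'' : (srwTrueAlt 10 (α : ℝ) afmax).IM 1 (l + 2) nd.pt ≤ IMc 1 (l + 2))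
    (hnum : boundHD75Phi (Tables.cell IMc (tNDX α nd) (KUSepD10R2.uNX nd) (kNX nd) : Tables (Fin 10 → ℤ)) 1 l 0 a ≤ b) :
    boundHD75Phi (srwTrueAlt 10 (α : ℝ) afmax) 1 l nd.pt a ≤ b :=
  boundHD75Phi_srwTrueAlt_one_at_le ha nd.pt hE1 hE0 hE1' hE0' hE1''
    (srwTS_pt_le_tNDX hα nd (by norm_num) (by norm_num) (by omega)) (srwTS_pt_le_tNDX hα nd (by norm_num) (by norm_num) (by omega))
    (srwTS_pt_le_tNDX hα nd (by norm_num) (by norm_num) (by omega))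
    (KUSepD10R2.srwU_pt_leX nd (by norm_num) (by norm_num) (by omega)) (KUSepD10R2.srwU_pt_leX nd (by norm_num) (by norm_num) (by omega))
    (srwK_pt_leX nd (by norm_num) (by norm_num) (by omega)) (srwK_pt_leX nd (by norm_num) (by norm_num) (by omega)) hnum

end Wired

/-- **Closing rule, Rev3 direct `T` slot AT the node `nd`**: `boundHD75PhiQ IMq (tNDQX α nd) (KUSepD10R2.uAX · · nd) (kAX · · nd) n l aq ≤ bq`
gives the `hnum` of `f3cellD10DX_{zero,one}_at_le_phi` — twin of `KUSepD10R2.boundHD75Phi_cellNDX_le_of_ratLe`. [cite: FitznerVanDerHofstad2016NoBLE, §3.3.5 (3.87) p. 1079; (3.58)–(3.64) p. 1076; §5.2 (5.9), (5.15) p. 1092] [cite: FitznerVanDerHofstad2017, §2.5] -/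
theorem boundHD75Phi_cellNDX_le_of_ratLe (IMq : ℤ → ℕ → ℚ) {α : ℚ} (nd : Nd) {n l : ℕ} {aq : ArgsQ} {bq : ℚ}
    (h : boundHD75PhiQ IMq (tNDQX α nd) (fun n l => KUSepD10R2.uAX n l nd) (fun n l => kAX n l nd) n l aq ≤ bq) :
    boundHD75Phi (Tables.cell (fun m l => ((IMq m l : ℚ) : ℝ)) (tNDX α nd) (KUSepD10R2.uNX nd) (kNX nd) : Tables (Fin 10 → ℤ)) n l 0
      aq.toArgs ≤ ((bq : ℚ) : ℝ) :=
  boundHD75Phi_cell_le_of_ratLe IMq (tNDQX α nd) (fun n l => KUSepD10R2.uAX n l nd) (fun n l => kAX n l nd) 0 h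

section Slot

variable {α amax bq : ℚ} {aq : ArgsQ} {IMq : ℤ → ℕ → ℚ} {l : ℕ}

/-- **Cell `(0,l)` AT a node `nd ∈ 𝒳`, `boundHD75Phi`, Rev3 / Rev2 tables, all hypotheses decidable** (`l ≤ 16`) — twin of
`KUSepD10R2.slotNDX_zero_at_le_phi` with `hnum` over `tNDQX` (Rev3), `KUSepD10R2.uAX`, `kAX` (Rev3). [cite: FitznerVanDerHofstad2016NoBLE, §3.3.5 (3.87) p. 1079; (3.58)–(3.64) p. 1076; §5.2 (5.9), (5.15) p. 1092] [cite: FitznerVanDerHofstad2017, §2.5] -/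
theorem slotNDX_zero_at_le_phi (nd : Nd) (hnd : nd.pt ∈ calX 10) (hα : 1 ≤ α) (hᾱ : 1 ≤ amax) (hwf : aq.wfCheck = true) (hl : l ≤ 16)
    (hE0 : cellChk α amax 0 l (IMq 0 l) = true) (hE0' : cellChk α amax 0 (l + 1) (IMq 0 (l + 1)) = true)
    (hN1 : negOneFstChk α l (IMq (-1) l) = true) (hN2 : negOneSndChk α l (IMq (-1) l) = true)
    (hnum : boundHD75PhiQ IMq (tNDQX α nd) (fun n l => KUSepD10R2.uAX n l nd) (fun n l => kAX n l nd) 0 l aq ≤ bq) :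
    boundHD75Phi (srwTrueAlt 10 (α : ℝ) (amax : ℝ)) 0 l nd.pt aq.toArgs ≤ ((bq : ℚ) : ℝ) :=
  have hα0 : 0 < α := by linarith
  have hαR : (0 : ℝ) < (α : ℝ) := by exact_mod_cast hα0
  have hN := negOne_pair_at_of_chk hnd hα0 hN1 hN2
  f3cellD10DX_zero_at_le_phi (afmax := (amax : ℝ)) hα (ArgsQ.toArgs_WF hwf) nd
    (IMc := fun m l => ((IMq m l : ℚ) : ℝ)) hl
    (srwTrueAlt_IM_natCast_le_of_cellDomAlt hαR (by exact_mod_cast hᾱ) (by norm_num) (cellDomAlt_of_chk hα0 hᾱ hE0) hnd)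
    (srwTrueAlt_IM_natCast_le_of_cellDomAlt hαR (by exact_mod_cast hᾱ) (by norm_num) (cellDomAlt_of_chk hα0 hᾱ hE0') hnd)
    hN.1 hN.2 (boundHD75Phi_cellNDX_le_of_ratLe IMq nd hnum)

/-- **Cells `(1,l)` AT a node `nd ∈ 𝒳`, `boundHD75Phi`, Rev3 / Rev2 tables, all hypotheses decidable** (`l ≤ 16`) — twin of
`KUSepD10R2.slotNDX_one_at_le_phi`. [cite: FitznerVanDerHofstad2016NoBLE, §3.3.5 (3.87) p. 1079; (3.58)–(3.64) p. 1076; §5.2 (5.9), (5.15) p. 1092] [cite: FitznerVanDerHofstad2017, §2.5] -/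
theorem slotNDX_one_at_le_phi (nd : Nd) (hnd : nd.pt ∈ calX 10) (hα : 1 ≤ α) (hᾱ : 1 ≤ amax) (hwf : aq.wfCheck = true) (hl : l ≤ 16)
    (hE1 : cellChk α amax 1 l (IMq 1 l) = true) (hE0 : cellChk α amax 0 l (IMq 0 l) = true)
    (hE1' : cellChk α amax 1 (l + 1) (IMq 1 (l + 1)) = true) (hE0' : cellChk α amax 0 (l + 1) (IMq 0 (l + 1)) = true)
    (hE1'' : cellChk α amax 1 (l + 2) (IMq 1 (l + 2)) = true)
    (hnum : boundHD75PhiQ IMq (tNDQX α nd) (fun n l => KUSepD10R2.uAX n l nd) (fun n l => kAX n l nd) 1 l aq ≤ bq) :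
    boundHD75Phi (srwTrueAlt 10 (α : ℝ) (amax : ℝ)) 1 l nd.pt aq.toArgs ≤ ((bq : ℚ) : ℝ) :=
  have hα0 : 0 < α := by linarith
  have hαR : (0 : ℝ) < (α : ℝ) := by exact_mod_cast hα0
  have hᾱR : (1 : ℝ) ≤ (amax : ℝ) := by exact_mod_cast hᾱ
  f3cellD10DX_one_at_le_phi (afmax := (amax : ℝ)) hα (ArgsQ.toArgs_WF hwf) nd
    (IMc := fun m l => ((IMq m l : ℚ) : ℝ)) hl
    (srwTrueAlt_IM_natCast_le_of_cellDomAlt hαR hᾱR (by norm_num) (cellDomAlt_of_chk hα0 hᾱ hE1) hnd)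
    (srwTrueAlt_IM_natCast_le_of_cellDomAlt hαR hᾱR (by norm_num) (cellDomAlt_of_chk hα0 hᾱ hE0) hnd)
    (srwTrueAlt_IM_natCast_le_of_cellDomAlt hαR hᾱR (by norm_num) (cellDomAlt_of_chk hα0 hᾱ hE1') hnd)
    (srwTrueAlt_IM_natCast_le_of_cellDomAlt hαR hᾱR (by norm_num) (cellDomAlt_of_chk hα0 hᾱ hE0') hnd)
    (srwTrueAlt_IM_natCast_le_of_cellDomAlt hαR hᾱR (by norm_num) (cellDomAlt_of_chk hα0 hᾱ hE1'') hnd)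
    (boundHD75Phi_cellNDX_le_of_ratLe IMq nd hnum)

end Slot

end KUSepD10R3

end Literature.Probability.FitznerVanDerHofstad2017
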